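import Summits.QuantumAdvantage.AdviceFreeQNC0.AffBells37Expansion
import HarnessLib

/-!
# AffBells37 (6/6) — THE ASSEMBLY and **(NP₁) `AffBells26.AffBellsPolyLoss3` PROVED**

Cell qa-qnc0, route DWalkThree (crux stmt-QuantumAdvantage-22907; rung (NP₁) `AffBells26.AffBellsPolyLoss3`).  AUTHORED AND PROVED BY THE PLANNER qa-qnc0-p2 gen 34 (memo `HOME/qa-qnc0-p2/ROUND-34P2.md`, INBOX P2-34a/b, 2026-08-29); landed verbatim by qn-prover-3.  Part 6/6 of the all-firsts PAIR-SLICING + `𝔽₄`-KRAFT proof of (NP₁); the six parts are a mechanical split (≤ 400 lines each) of one kernel-checked file `AffBells37.lean` (rc 0, 0 sorries, axioms propext/Classical.choice/Quot.sound).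

`affBellsPolyLoss3_of_stubs : SliceExpansion → ResonanceMGF → AffBellsPolyLoss3` with `e = 5`, `n₀ = 200`: transport to the walk cube (`S1`);
cover it by the pair slices (`sum_sum_U`); a slice is GOOD if the Kraft mass of its family is `< 1` — then the family does not represent `1`
(`exists_ne_one_of_mass_lt`, part 1), so by sparsity (`sparse_ne_one`, part 2; `K + 1 ≤ 4(n+1)²` rows) it loses `≥ 2^{Fn}/(n+1)^5` of its
`2^{Fn}` points (`card_loss_slice` + `SliceExpansion`); BAD slices have mass `≥ 1`, and by `mass_rows_le` + (R) + Markov at most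
`2ⁿ·(2(n+1)(1+8Fn) + 4(n+1)(3/2)^{Fn})/2^{Fn} ≤ 2ⁿ/2` bases are bad (`growth1/2`, `Fn ≥ 30`).  Hence `affWinCard β c ≤ (1 − N^{−5})·2^{N−1}`
for `N ≥ 200`.  **`theorem affBellsPolyLoss3 : AffBellsPolyLoss3`** — every affine MOD₃ bell strategy (with the canonical guess) loses at least a
`N^{-5}` fraction of the odd inputs of the cyclic-shift ring game; unconditional, closing the rung (NP₁) of `AffBells26MoveSystems` that
`AffBells29–36` reached only under hypotheses (`HCube`, `HDrop`, `WideRowElimination`, `NearPerfectAligned`, …).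
WHAT THIS IS NOT: not `RingAffineBellsLt3` (constant fraction) and nothing on bells of degree `≥ 2` (`RingHardOdd 3`): the method needs the
win bit to be a SPARSE LOW-WEIGHT character sum on a slice, which fails for `ω^{quadratic}`.
-/

noncomputable section

namespace Summit.QuantumAdvantage.AdviceFreeQNC0.AffBells37

open Finset F4
open Classical

section Slicing

open Literature.Computability.QuantumComplexity Literature.Computability.QuantumComplexity.RingHLF
open AffBells23 AffBells26

variable {F : ℕ} {ι : Type*} {n : ℕ}

/-! ### THE ASSEMBLY: `SliceExpansion → ResonanceMGF → AffBellsPolyLoss3` -/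

/-- losing points seen through a slice are counted by the family (`SliceExpansion`). -/
theorem card_loss_slice (hE : SliceExpansion) (hn : 4 ≤ n) (β : Fin (n + 1) → Fin (n + 1) → ZMod 3)
    (c : Fin (n + 1) → ZMod 3) (a : Fin n → Bool) :
    (univ.filter fun v : Fin (Fn n) → Bool => ev univ (rows β a) (coefs β c a) v ≠ 1).card
      = (univ.filter fun v : Fin (Fn n) → Bool => Wn β c (U a v) = false).card := by
  refine congrArg Finset.card (filter_congr fun v _ => ?_)
  rw [← hE n hn β c a v]
  haveI := F4.nontrivial
  unfold ιF
  cases Wn β c (U a v)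
  · simp
  · simp

/-- **The all-firsts pair-slicing theorem**: `(E) ∧ (R) ⇒ (NP₁)` with `e = 5`, `n₀ = 200`. -/
theorem affBellsPolyLoss3_of_stubs (hE : SliceExpansion) (hR : ResonanceMGF) : AffBellsPolyLoss3 := by
  refine ⟨5, 200, fun N hN β c => ?_⟩
  obtain ⟨n, rfl⟩ : ∃ n, N = n + 1 := ⟨N - 1, by omega⟩
  have hn : 199 ≤ n := by omega
  have hFn : 30 ≤ Fn n := by unfold Fn; omega
  have h3Fn : n + 1 ≤ 3 * Fn n + 4 := by unfold Fn; omega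
  haveI := F4.nontrivial
  -- wins and losses of the transported game
  set Los := univ.filter (fun u : Fin n → Bool => Wn β c u = false) with hLos
  have hWL : (univ.filter fun u : Fin n → Bool => Wn β c u = true).card + Los.card = 2 ^ n := by
    have h := Finset.card_filter_add_card_filter_not (s := (univ : Finset (Fin n → Bool)))
      (fun u => Wn β c u = true)
    rw [card_univ, Fintype.card_fun, Fintype.card_bool, Fintype.card_fin] at h
    rw [← h, hLos]
    congr 2
    exact filter_congr fun u _ => by cases Wn β c u <;> simp
  have hS1 := S1 (by omega) β c
  -- masses of slices
  set K := Fintype.card (Ix n) with hK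
  set massN : (Fin n → Bool) → ℕ := fun a => ∑ b : Ix n, 2 ^ (Fn n - wt (rows β a b)) with hmassN
  set Good := univ.filter (fun a : Fin n → Bool => massN a < 2 ^ Fn n) with hGood
  set Bad := univ.filter (fun a : Fin n → Bool => ¬ massN a < 2 ^ Fn n) with hBad
  have hGB : Good.card + Bad.card = 2 ^ n := by
    rw [hGood, hBad, Finset.card_filter_add_card_filter_not, card_univ, Fintype.card_fun, Fintype.card_bool,
      Fintype.card_fin]
  -- Step A: a good slice loses `≥ 2^{Fn} / 2^{L(K+1)}` points
  set cnt : (Fin n → Bool) → ℕ := fun a => (univ.filter fun v : Fin (Fn n) → Bool => Wn β c (U a v) = false).card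
    with hcnt
  have hA : ∀ a ∈ Good, 2 ^ Fn n ≤ 2 ^ L (K + 1) * cnt a := by
    intro a ha
    rw [hGood, mem_filter] at ha
    have hex := exists_ne_one_of_mass_lt (Fn n) univ (rows β a) (coefs β c a) ha.2
    have hsp := sparse_ne_one (Fn n) univ (rows β a) (coefs β c a) hex
    rw [card_univ, ← hK, card_loss_slice hE (by omega) β c a] at hsp
    exact hsp
  -- Step B: summing over good slices and re-randomising: `#Good ≤ 2^{L(K+1)} · #Los`
  have hsumcnt : ∑ a : Fin n → Bool, cnt a = 2 ^ Fn n * Los.card := by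
    have h1 : ∀ a, cnt a = ∑ v : Fin (Fn n) → Bool, (if Wn β c (U a v) = false then 1 else 0) := by
      intro a; rw [hcnt]; exact card_filter _ _
    simp_rw [h1]
    rw [sum_comm, sum_sum_U (fun u => if Wn β c u = false then 1 else 0), hLos, card_filter]
  have hB : Good.card ≤ 2 ^ L (K + 1) * Los.card := by
    have h1 : Good.card * 2 ^ Fn n ≤ 2 ^ L (K + 1) * (2 ^ Fn n * Los.card) := by
      calc Good.card * 2 ^ Fn n = ∑ a ∈ Good, 2 ^ Fn n := by rw [sum_const, smul_eq_mul]
        _ ≤ ∑ a ∈ Good, 2 ^ L (K + 1) * cnt a := sum_le_sum hA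
        _ ≤ ∑ a, 2 ^ L (K + 1) * cnt a :=
            sum_le_sum_of_subset_of_nonneg (subset_univ _) fun _ _ _ => Nat.zero_le _
        _ = 2 ^ L (K + 1) * (2 ^ Fn n * Los.card) := by rw [← mul_sum, hsumcnt]
    have hpos : 0 < 2 ^ Fn n := by positivity
    rw [show 2 ^ L (K + 1) * (2 ^ Fn n * Los.card) = (2 ^ L (K + 1) * Los.card) * 2 ^ Fn n by ring] at h1
    exact Nat.le_of_mul_le_mul_right h1 hpos
  -- Step C: bad slices are rare (mass bookkeeping + resonance MGF + Markov)
  set C : ℕ := 2 * (n + 1) * (1 + 8 * Fn n) with hC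
  set T : (Fin n → Bool) → ℝ := fun a => ∑ g : Fin (n + 1), ∑ σ : Bool, ∑ k : Fin 3,
      (if k = 0 then (0 : ℝ) else (2 : ℝ) ^ Zcount β a g (σv σ) ((k.val : ℕ) : ZMod 3)) with hT
  have hmass : ∀ a, (massN a : ℝ) ≤ C + T a := by
    intro a
    have h := mass_rows_le β a
    have h' : ((massN a : ℕ) : ℝ) ≤ ((2 * (n + 1) * (1 + 8 * Fn n) +
        ∑ g : Fin (n + 1), ∑ σ : Bool, ∑ k : Fin 3,
          (if k = 0 then 0 else 2 ^ Zcount β a g (σv σ) ((k.val : ℕ) : ZMod 3)) : ℕ) : ℝ) := by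
      exact_mod_cast h
    have hC' : (C : ℝ) = 2 * ((n : ℝ) + 1) * (1 + 8 * (Fn n : ℝ)) := by rw [hC]; push_cast; ring
    have hT' : T a = ∑ g : Fin (n + 1), ∑ σ : Bool, ∑ k : Fin 3,
        (if k = 0 then (0 : ℝ) else (2 : ℝ) ^ Zcount β a g (σv σ) ((k.val : ℕ) : ZMod 3)) := rfl
    rw [hC', hT']
    push_cast at h'
    linarith
  have hTsum : ∑ a : Fin n → Bool, T a ≤ 4 * (n + 1) * ((2 : ℝ) ^ n * (3 / 2 : ℝ) ^ Fn n) := by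
    rw [hT, sum_comm]
    have hg : ∀ g : Fin (n + 1), ∑ a : Fin n → Bool, ∑ σ : Bool, ∑ k : Fin 3,
        (if k = 0 then (0 : ℝ) else (2 : ℝ) ^ Zcount β a g (σv σ) ((k.val : ℕ) : ZMod 3))
          ≤ 4 * ((2 : ℝ) ^ n * (3 / 2 : ℝ) ^ Fn n) := by
      intro g
      rw [sum_comm]
      have hσ : ∀ σ : Bool, ∑ a : Fin n → Bool, ∑ k : Fin 3,
          (if k = 0 then (0 : ℝ) else (2 : ℝ) ^ Zcount β a g (σv σ) ((k.val : ℕ) : ZMod 3))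
            ≤ 2 * ((2 : ℝ) ^ n * (3 / 2 : ℝ) ^ Fn n) := by
        intro σ
        rw [sum_comm]
        have hk : ∀ k : Fin 3, ∑ a : Fin n → Bool,
            (if k = 0 then (0 : ℝ) else (2 : ℝ) ^ Zcount β a g (σv σ) ((k.val : ℕ) : ZMod 3))
              ≤ (if k = 0 then (0 : ℝ) else (2 : ℝ) ^ n * (3 / 2 : ℝ) ^ Fn n) := by
          intro k
          by_cases hk0 : k = 0
          · simp [hk0]
          · simp only [hk0, if_false]
            have hkz : ((k.val : ℕ) : ZMod 3) ≠ 0 := by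
              have : k = 1 ∨ k = 2 := by omega
              rcases this with rfl | rfl <;> decide
            exact hR n β g (σv σ) _ (σv_ne_zero σ) hkz
        calc _ ≤ ∑ k : Fin 3, (if k = 0 then (0 : ℝ) else (2 : ℝ) ^ n * (3 / 2 : ℝ) ^ Fn n) := sum_le_sum fun k _ => hk k
          _ = 2 * ((2 : ℝ) ^ n * (3 / 2 : ℝ) ^ Fn n) := by rw [Fin.sum_univ_three]; simp; ring
      calc _ ≤ ∑ σ : Bool, 2 * ((2 : ℝ) ^ n * (3 / 2 : ℝ) ^ Fn n) := sum_le_sum fun σ _ => hσ σ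
        _ = _ := by rw [Fintype.sum_bool]; ring
    calc _ ≤ ∑ g : Fin (n + 1), 4 * ((2 : ℝ) ^ n * (3 / 2 : ℝ) ^ Fn n) := sum_le_sum fun g _ => hg g
      _ = _ := by rw [sum_const, card_univ, Fintype.card_fin]; ring
  have hBadR : (Bad.card : ℝ) * ((2 : ℝ) ^ Fn n - C) ≤ 4 * (n + 1) * ((2 : ℝ) ^ n * (3 / 2 : ℝ) ^ Fn n) := by
    have h1 : ∀ a ∈ Bad, ((2 : ℝ) ^ Fn n - C) ≤ T a := by
      intro a ha
      rw [hBad, mem_filter, not_lt] at ha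
      have h2 : ((2 ^ Fn n : ℕ) : ℝ) ≤ (massN a : ℝ) := by exact_mod_cast ha.2
      push_cast at h2
      linarith [hmass a]
    have hTnn : ∀ a, 0 ≤ T a := by
      intro a; rw [hT]
      exact sum_nonneg fun g _ => sum_nonneg fun σ _ => sum_nonneg fun k _ => by split_ifs <;> positivity
    calc (Bad.card : ℝ) * ((2 : ℝ) ^ Fn n - C) = ∑ a ∈ Bad, ((2 : ℝ) ^ Fn n - C) := by
          rw [sum_const, nsmul_eq_mul]
      _ ≤ ∑ a ∈ Bad, T a := sum_le_sum h1
      _ ≤ ∑ a, T a := sum_le_sum_of_subset_of_nonneg (subset_univ _) fun a _ _ => hTnn a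
      _ ≤ _ := hTsum
  -- Step D: the numbers
  have hg1 := growth1 (Fn n) hFn
  have hg2 := growth2 (Fn n) hFn
  have hC2 : 2 * (C : ℝ) ≤ (2 : ℝ) ^ Fn n := by
    have h : 2 * C ≤ 2 ^ Fn n := by
      calc 2 * C = 4 * (n + 1) * (1 + 8 * Fn n) := by rw [hC]; ring
        _ ≤ 4 * (3 * Fn n + 4) * (1 + 8 * Fn n) := by
            apply Nat.mul_le_mul_right; apply Nat.mul_le_mul_left; exact h3Fn
        _ ≤ 2 ^ Fn n := hg2
    exact_mod_cast h
  have h34 : 16 * ((n : ℝ) + 1) * (3 : ℝ) ^ Fn n ≤ (4 : ℝ) ^ Fn n := by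
    have h : 16 * (n + 1) * 3 ^ Fn n ≤ 4 ^ Fn n := by
      calc 16 * (n + 1) * 3 ^ Fn n ≤ 16 * (3 * Fn n + 4) * 3 ^ Fn n := by
            apply Nat.mul_le_mul_right; apply Nat.mul_le_mul_left; exact h3Fn
        _ ≤ 4 ^ Fn n := hg1
    exact_mod_cast h
  have hBadle : (Bad.card : ℝ) ≤ (2 : ℝ) ^ n / 2 := by
    have hpos2 : (0 : ℝ) < (2 : ℝ) ^ Fn n := by positivity
    have hCnn : (0 : ℝ) ≤ C := by positivity
    -- Bad · 2^Fn / 2 ≤ Bad · (2^Fn − C) ≤ 4(n+1) 2^n (3/2)^Fn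
    have h1 : (Bad.card : ℝ) * ((2 : ℝ) ^ Fn n / 2) ≤ 4 * (n + 1) * ((2 : ℝ) ^ n * (3 / 2 : ℝ) ^ Fn n) := by
      have hb : (0 : ℝ) ≤ Bad.card := by positivity
      calc (Bad.card : ℝ) * ((2 : ℝ) ^ Fn n / 2) ≤ (Bad.card : ℝ) * ((2 : ℝ) ^ Fn n - C) :=
            mul_le_mul_of_nonneg_left (by linarith) hb
        _ ≤ _ := hBadR
    have h32 : (3 / 2 : ℝ) ^ Fn n * (2 : ℝ) ^ Fn n = (3 : ℝ) ^ Fn n := by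
      rw [← mul_pow]; norm_num
    have h42 : (4 : ℝ) ^ Fn n = (2 : ℝ) ^ Fn n * (2 : ℝ) ^ Fn n := by
      rw [← mul_pow]; norm_num
    -- divide through by `p = 2^{Fn}`
    have key : (16 * ((n : ℝ) + 1) * (3 / 2 : ℝ) ^ Fn n) * (2 : ℝ) ^ Fn n ≤ (2 : ℝ) ^ Fn n * (2 : ℝ) ^ Fn n := by
      calc (16 * ((n : ℝ) + 1) * (3 / 2 : ℝ) ^ Fn n) * (2 : ℝ) ^ Fn n
          = 16 * ((n : ℝ) + 1) * ((3 / 2 : ℝ) ^ Fn n * (2 : ℝ) ^ Fn n) := by ring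
        _ = 16 * ((n : ℝ) + 1) * (3 : ℝ) ^ Fn n := by rw [h32]
        _ ≤ (4 : ℝ) ^ Fn n := h34
        _ = (2 : ℝ) ^ Fn n * (2 : ℝ) ^ Fn n := h42
    have h34' : 16 * ((n : ℝ) + 1) * (3 / 2 : ℝ) ^ Fn n ≤ (2 : ℝ) ^ Fn n := le_of_mul_le_mul_right key hpos2
    have h2 : (Bad.card : ℝ) * ((2 : ℝ) ^ Fn n / 2) ≤ ((2 : ℝ) ^ n / 2) * ((2 : ℝ) ^ Fn n / 2) :=
      h1.trans (by
        calc 4 * ((n : ℝ) + 1) * ((2 : ℝ) ^ n * (3 / 2 : ℝ) ^ Fn n)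
            = ((2 : ℝ) ^ n / 4) * (16 * ((n : ℝ) + 1) * (3 / 2 : ℝ) ^ Fn n) := by ring
          _ ≤ ((2 : ℝ) ^ n / 4) * (2 : ℝ) ^ Fn n := mul_le_mul_of_nonneg_left h34' (by positivity)
          _ = ((2 : ℝ) ^ n / 2) * ((2 : ℝ) ^ Fn n / 2) := by ring)
    exact le_of_mul_le_mul_right h2 (by positivity)
  -- Step E: conclude
  have hK1 : K + 1 ≤ 4 * (n + 1) ^ 2 := by
    rw [hK, card_Ix]
    have h8 : 6 + 8 * Fn n ≤ 4 * n + 3 := by unfold Fn; omega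
    calc (n + 1) * (6 + 8 * Fn n) + 1 ≤ (n + 1) * (4 * n + 3) + (n + 1) :=
          Nat.add_le_add (Nat.mul_le_mul_left _ h8) (by omega)
      _ = 4 * (n + 1) ^ 2 := by ring
  have hLK : 2 ^ (L (K + 1) + 1) ≤ (n + 1) ^ 5 := by
    have h1 := two_pow_L_le (K + 1) (by omega)
    have h2 : (K + 1) ^ 2 ≤ (4 * (n + 1) ^ 2) ^ 2 := Nat.pow_le_pow_left hK1 2
    have h3 : 128 ≤ n + 1 := by omega
    calc 2 ^ (L (K + 1) + 1) = 2 * 2 ^ L (K + 1) := by ring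
      _ ≤ 2 * (4 * (4 * (n + 1) ^ 2) ^ 2) := Nat.mul_le_mul_left 2 (h1.trans (Nat.mul_le_mul_left 4 h2))
      _ = 128 * (n + 1) ^ 4 := by ring
      _ ≤ (n + 1) * (n + 1) ^ 4 := Nat.mul_le_mul_right _ h3
      _ = (n + 1) ^ 5 := by ring
  -- real-number finish
  have hGoodR : (2 : ℝ) ^ n / 2 ≤ Good.card := by
    have h : ((Good.card + Bad.card : ℕ) : ℝ) = (2 : ℝ) ^ n := by rw [hGB]; push_cast; ring
    push_cast at h
    linarith
  have hLosR : (2 : ℝ) ^ n / 2 ≤ (2 : ℝ) ^ L (K + 1) * Los.card := by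
    have h : (Good.card : ℝ) ≤ ((2 ^ L (K + 1) * Los.card : ℕ) : ℝ) := by exact_mod_cast hB
    push_cast at h
    linarith
  have hWR : ((univ.filter fun u : Fin n → Bool => Wn β c u = true).card : ℝ) = (2 : ℝ) ^ n - Los.card := by
    have h : (((univ.filter fun u : Fin n → Bool => Wn β c u = true).card + Los.card : ℕ) : ℝ) = (2 : ℝ) ^ n := by
      rw [hWL]; push_cast; ring
    push_cast at h
    linarith
  have hpowL : (0 : ℝ) < (2 : ℝ) ^ L (K + 1) := by positivity
  have hN5 : (2 : ℝ) ^ (L (K + 1) + 1) ≤ ((n : ℝ) + 1) ^ 5 := by exact_mod_cast hLK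
  rw [pow_succ] at hN5
  have hNpos : (0 : ℝ) < ((n : ℝ) + 1) ^ 5 := by positivity
  rw [show n + 1 - 1 = n from rfl]
  push_cast
  calc (affWinCard β c : ℝ) ≤ ((univ.filter fun u : Fin n → Bool => Wn β c u = true).card : ℝ) := by
        exact_mod_cast hS1
    _ = (2 : ℝ) ^ n - Los.card := hWR
    _ ≤ (2 : ℝ) ^ n - (2 : ℝ) ^ n / (2 * (2 : ℝ) ^ L (K + 1)) := by
        have : (2 : ℝ) ^ n / (2 * (2 : ℝ) ^ L (K + 1)) ≤ Los.card := by
          rw [div_le_iff₀ (by positivity)]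
          calc (2 : ℝ) ^ n = 2 * ((2 : ℝ) ^ n / 2) := by ring
            _ ≤ 2 * ((2 : ℝ) ^ L (K + 1) * Los.card) := by linarith
            _ = (Los.card : ℝ) * (2 * (2 : ℝ) ^ L (K + 1)) := by ring
        linarith
    _ ≤ (1 - 1 / ((n : ℝ) + 1) ^ 5) * (2 : ℝ) ^ n := by
        have h2n : (0 : ℝ) < (2 : ℝ) ^ n := by positivity
        have : (2 : ℝ) ^ n / ((n : ℝ) + 1) ^ 5 ≤ (2 : ℝ) ^ n / (2 * (2 : ℝ) ^ L (K + 1)) := by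
          apply div_le_div_of_nonneg_left (le_of_lt h2n) (by positivity)
          linarith
        rw [sub_mul, one_mul, one_div, inv_mul_eq_div]
        linarith

/-- **(NP₁) from the slice expansion alone** — (R) is proved above. -/
theorem affBellsPolyLoss3_of_sliceExpansion (hE : SliceExpansion) : AffBellsPolyLoss3 :=
  affBellsPolyLoss3_of_stubs hE resonanceMGF

/-- **(NP₁) PROVED**: affine `𝔽₃` bells lose a `≥ N^{-5}` fraction of the odd inputs of the cyclic-shift ring game. -/
theorem affBellsPolyLoss3 : AffBellsPolyLoss3 := affBellsPolyLoss3_of_sliceExpansion sliceExpansion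

/-- fully-qualified restatement (sanity: this is the tree's rung `(NP₁)` of `AffBells26MoveSystems`). -/
example : _root_.Summit.QuantumAdvantage.AdviceFreeQNC0.AffBells26.AffBellsPolyLoss3 := affBellsPolyLoss3

end Slicing

end Summit.QuantumAdvantage.AdviceFreeQNC0.AffBells37
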